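import Summits.AtomisticToContinuum.BoseEinsteinCondensation.Theorems.BECConjugateDominationHardCoreExtensionBoundedPositiveMinimiser
import Summits.AtomisticToContinuum.BoseEinsteinCondensation.Theorems.BECConjugateDominationHardCoreExtensionGroundStateRegularity
import Literature.MathematicalPhysics.QuantumManyBody.PeriodicGroundStateFeynmanKacProofs
import HarnessLib

/-!
# Positive `C¹` minimisers of the periodic `N`-body energy for BOUNDED admissible potentials — unconditional
# (node `boundedPositiveMinimiser` = v1's S6 of line `third-law-current-floor`, crux `HardCoreExtension`,
# stmt-AtomisticToContinuum-11786)

For every repulsive finite-range pair potential `v` that is BOUNDED (`v ≤ M < ⊤`; measurable, possibly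
discontinuous: square wells, shells, steps, truncated hard cores `min(⊤·1_{[0,a]}, n)`), every particle number
`n + 1 ≥ 1` and every torus side `L > 0`, the periodic `(n+1)`-body energy `periodicEnergy v` has a minimiser in the
`C¹` periodic Bose class `PeriodicTrialState (n+1) L` which has finite energy, is real, nonnegative and POINTWISE
NON-ZERO (hence strictly positive). Assembly of three landed pieces of the line: S6' `stub_boundedPositiveMinimiser`
(p92481: conditional on the Feynman–Kac package and on `C¹`-regularity), the discharged named fact
`PeriodicGroundStateFeynmanKac_holds` (p91527) and S6r `stub_periodicGroundStateRegularity` (p100228: `C¹`-regularity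
of the Feynman–Kac ground state for bounded measurable periodised potentials, by the mild/forward Duhamel identities
p98922/p98804 and Gaussian smoothing of bounded measurable data). This extends the route's closed support item
`PositiveMinimiser` (smooth class, `C³`) to the whole bounded measurable class, which is what the line's
thermodynamic stubs S2/S3/S4 are quantified over and what the truncation transfer S7 consumes at every height `n`.
-/

noncomputable section

namespace Summit.AtomisticToContinuum.BoseEinsteinCondensation.Cruxes.HardCoreExtension.ThirdLawCurrentFloor

open MeasureTheory
open scoped ENNReal NNReal
open Literature.MathematicalPhysics.QuantumManyBody.BoseGas

/-- **Positive `C¹` minimisers for bounded admissible potentials (unconditional).** For every bounded repulsive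
finite-range pair potential `v`, every `n` and every `L > 0`, the periodic `(n+1)`-body energy on the torus of
side `L` has a minimiser in the `C¹` periodic Bose class, of finite energy, real nonnegative and pointwise
non-zero: S6' (`stub_boundedPositiveMinimiser`) fed with `PeriodicGroundStateFeynmanKac_holds` and S6r
(`stub_periodicGroundStateRegularity`). [folklore; ReedSimonIV1978 Thm XIII.47 and GilbargTrudinger2001 Thm 8.8
for the classical statements] -/
theorem stub_boundedPositiveMinimiserHolds :
    ∀ v : ℝ → ℝ≥0∞, IsRepulsiveFiniteRange v → (∃ M : ℝ≥0∞, M ≠ ⊤ ∧ ∀ r, v r ≤ M) →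
      ∀ (n : ℕ) (L : ℝ), 0 < L → ∃ Ψ : PeriodicTrialState (n + 1) L,
        periodicEnergy v Ψ = periodicGroundStateEnergy v (n + 1) L ∧ periodicEnergy v Ψ ≠ ⊤ ∧
        (∀ X, Ψ.ψ X = (‖Ψ.ψ X‖ : ℂ)) ∧ (∀ X, Ψ.ψ X ≠ 0) :=
  stub_boundedPositiveMinimiser PeriodicGroundStateFeynmanKac_holds stub_periodicGroundStateRegularity

/-- **Existence of positive `C¹` periodic minimisers, bounded admissible class** (the same theorem under its
skeleton name `boundedPositiveMinimiser`, for importers). [folklore] -/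
theorem boundedPositiveMinimiser_holds {v : ℝ → ℝ≥0∞} (hv : IsRepulsiveFiniteRange v)
    (hM : ∃ M : ℝ≥0∞, M ≠ ⊤ ∧ ∀ r, v r ≤ M) (n : ℕ) {L : ℝ} (hL : 0 < L) :
    ∃ Ψ : PeriodicTrialState (n + 1) L,
      periodicEnergy v Ψ = periodicGroundStateEnergy v (n + 1) L ∧ periodicEnergy v Ψ ≠ ⊤ ∧
      (∀ X, Ψ.ψ X = (‖Ψ.ψ X‖ : ℂ)) ∧ (∀ X, Ψ.ψ X ≠ 0) :=
  stub_boundedPositiveMinimiserHolds v hv hM n L hL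

/-- **Corollary: finiteness of the periodic ground-state energy for bounded admissible potentials** at every
`(n+1, L)`, `L > 0` (a minimiser of finite energy exists). [folklore] -/
theorem periodicGroundStateEnergy_ne_top_of_bounded {v : ℝ → ℝ≥0∞} (hv : IsRepulsiveFiniteRange v)
    (hM : ∃ M : ℝ≥0∞, M ≠ ⊤ ∧ ∀ r, v r ≤ M) (n : ℕ) {L : ℝ} (hL : 0 < L) :
    periodicGroundStateEnergy v (n + 1) L ≠ ⊤ := by
  obtain ⟨Ψ, hE, hfin, -, -⟩ := boundedPositiveMinimiser_holds hv hM n hL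
  rwa [← hE]

end Summit.AtomisticToContinuum.BoseEinsteinCondensation.Cruxes.HardCoreExtension.ThirdLawCurrentFloor

end
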